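import Mathlib.Analysis.Calculus.ContDiff.Bounds
import Mathlib.Analysis.Calculus.IteratedDeriv.Lemmas
import Mathlib.Analysis.Calculus.Deriv.Pow
import Mathlib.Analysis.Normed.Operator.Prod
import Mathlib.Analysis.SpecialFunctions.ExpDeriv
import Mathlib.Analysis.SpecialFunctions.Exponential
import Mathlib.Analysis.Complex.RealDeriv
import Mathlib.Analysis.SpecificLimits.Normed
import HarnessLib

/-!
# Calculus for the density of Laplace transforms: coordinate products, truncated exponentials,
the exponential change of variables

Topic `Literature/Analysis/Distribution`; generic `C^n`-estimates used in the proof that Laplace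
transforms of test functions supported in an open orthant are dense in the Schwartz functions
on the closed dual orthant (Osterwalder–Schrader I (1973), Lemma 8.2 and the Remark after
Lemma 8.4: "Lemmas 8.1–8.4 can immediately be generalized to the case of several variables";
files `LaplaceExpSums`, `LaplaceFourierDensity`). Everything here is elementary bookkeeping with
`iteratedFDeriv`:

* `ContDiff.mul_of_tsupport_subset` — a function smooth on an open set times a smooth function
  supported inside it is smooth;
* `prodCoord s u = ∏_{j ∈ s} u_j` on `ℝ^m` and `norm_iteratedFDeriv_prodCoord_le`:
  `‖Dⁿ ∏_{j∈s} u_j‖ ≤ (n+1)^{|s|}` on the unit cube (Leibniz);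
* `norm_iteratedFDeriv_realComp_clm_le` — `‖Dⁿ(h ∘ ℓ)(v)‖ ≤ ‖h⁽ⁿ⁾(ℓ v)‖ ‖ℓ‖ⁿ` for a scalar
  function `h` of one real variable and a real linear functional `ℓ` (the complex-form version is
  `norm_iteratedFDeriv_comp_clm_le` of `ExpCutoffCalculus`);
* the truncated exponential `expTrunc N t = ∑_{l ≤ N} (it)^l / l!`, its tail
  `expTail N = e^{it} − expTrunc N t`, `deriv (expTail (N+1)) = i • expTail N`, hence
  `iteratedDeriv j (expTail (N + j)) = i^j • expTail N`, and the uniform bound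
  `‖expTail N t‖ ≤ 2 |t|^{N+1}/(N+1)!` for `N + 2 ≥ 2|t|` (`Complex.exp_bound'`), whence
  `tendsto_expTail_iteratedDeriv`: all derivatives of order `≤ n` of `expTail N` tend to `0`
  uniformly on bounded sets as `N → ∞`;
* `norm_iteratedFDeriv_pi`, `norm_iteratedFDeriv_prodMk_le` — sup formulas for vector-valued maps;
* `expNegMap (σ, q) = ((e^{−σᵢ})ᵢ, q)` on `ℝ^m × W` and `norm_iteratedFDeriv_expNegMap_le`: all its
  derivatives of order `≥ 1` are bounded by `e` on `{σᵢ ≥ −1}` — the input `D` of Mathlib's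
  Faà di Bruno estimate `norm_iteratedFDeriv_comp_le`.

## References

* K. Osterwalder, R. Schrader, *Axioms for Euclidean Green's functions*, Comm. Math. Phys. 31
  (1973) 83–112, §8, Lemma 8.2. [OsterwalderSchraderCMP1973]
-/

noncomputable section

open Filter Topology Set Complex
open scoped ContDiff Nat

namespace Literature.Analysis.Distribution

/-! ### Smoothness of cut-off functions -/

section Cutoff

variable {E : Type*} [NormedAddCommGroup E] [NormedSpace ℝ E]

/-- A function smooth on an open set `U`, multiplied by a smooth function supported inside `U`,
is smooth everywhere (outside `tsupport g` the product vanishes identically). [folklore] -/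
theorem ContDiff.mul_of_tsupport_subset {f g : E → ℂ} {U : Set E} (hU : IsOpen U)
    (hf : ContDiffOn ℝ ∞ f U) (hg : ContDiff ℝ ∞ g) (hsupp : tsupport g ⊆ U) :
    ContDiff ℝ ∞ fun x => f x * g x := by
  refine contDiff_iff_contDiffAt.2 fun x => ?_
  by_cases hx : x ∈ U
  · exact (hf.contDiffAt (hU.mem_nhds hx)).mul hg.contDiffAt
  · have hx' : x ∉ tsupport g := fun h => hx (hsupp h)
    have h0 : g =ᶠ[𝓝 x] 0 := notMem_tsupport_iff_eventuallyEq.1 hx'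
    have h0' : (fun y => f y * g y) =ᶠ[𝓝 x] fun _ => 0 := by
      filter_upwards [h0] with y hy
      rw [hy, Pi.zero_apply, mul_zero]
    exact (contDiffAt_const (c := (0 : ℂ))).congr_of_eventuallyEq h0'

end Cutoff

/-! ### Products of coordinates on `ℝ^m` -/

section ProdCoord

variable {m : ℕ}

/-- The product of the coordinates indexed by `s`: `prodCoord s u = ∏_{j ∈ s} u_j`. [folklore] -/
def prodCoord (s : Finset (Fin m)) : (Fin m → ℝ) → ℝ := fun u => ∏ j ∈ s, u j

/-- Unfolding `prodCoord`. [folklore] -/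
theorem prodCoord_apply (s : Finset (Fin m)) (u : Fin m → ℝ) : prodCoord s u = ∏ j ∈ s, u j := rfl

/-- The coordinate functional `u ↦ u_j` on `ℝ^m` has norm at most `1`. [folklore] -/
theorem norm_proj_le_one (j : Fin m) :
    ‖(ContinuousLinearMap.proj (R := ℝ) (φ := fun _ : Fin m => ℝ) j)‖ ≤ 1 :=
  ContinuousLinearMap.opNorm_le_bound _ zero_le_one fun u => by
    rw [one_mul]; exact norm_le_pi_norm u j

/-- Iterated derivatives of a coordinate functional: order `0` is the value, order `1` has norm
`≤ 1`, orders `≥ 2` vanish. [folklore] -/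
theorem norm_iteratedFDeriv_proj_le (j : Fin m) (u : Fin m → ℝ) (i : ℕ) :
    ‖iteratedFDeriv ℝ i (fun u : Fin m → ℝ => u j) u‖ ≤
      if i = 0 then |u j| else if i = 1 then 1 else 0 := by
  have hf : (fun u : Fin m → ℝ => u j) =
      ⇑(ContinuousLinearMap.proj (R := ℝ) (φ := fun _ : Fin m => ℝ) j) := rfl
  rcases i with _ | _ | i
  · simp [norm_iteratedFDeriv_zero]
  · simp only [if_true]
    rw [norm_iteratedFDeriv_one, hf, ContinuousLinearMap.fderiv]
    exact norm_proj_le_one j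
  · simp only [add_eq_zero, one_ne_zero, and_false, if_false, Nat.add_eq_right]
    have hfd : fderiv ℝ (fun u : Fin m → ℝ => u j) = fun _ =>
        (ContinuousLinearMap.proj (R := ℝ) (φ := fun _ : Fin m => ℝ) j) := by
      rw [hf]; funext u; exact ContinuousLinearMap.fderiv _
    rw [← norm_iteratedFDeriv_fderiv, hfd, iteratedFDeriv_succ_const, Pi.zero_apply, norm_zero]

/-- `prodCoord` is smooth (a polynomial). [folklore] -/
theorem contDiff_prodCoord (s : Finset (Fin m)) {N : ℕ∞} : ContDiff ℝ N (prodCoord s) := by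
  unfold prodCoord
  exact contDiff_prod fun j _ => contDiff_apply ℝ ℝ j

/-- **Derivatives of `∏_{j∈s} u_j` on the unit cube**: `‖Dⁿ prodCoord s (u)‖ ≤ (n+1)^{|s|}` whenever
`|u_j| ≤ 1` for all `j` (Leibniz rule, induction on `s`). [folklore] -/
theorem norm_iteratedFDeriv_prodCoord_le (s : Finset (Fin m)) {u : Fin m → ℝ}
    (hu : ∀ j, |u j| ≤ 1) (n : ℕ) :
    ‖iteratedFDeriv ℝ n (prodCoord s) u‖ ≤ (n + 1 : ℝ) ^ s.card := by
  classical
  induction s using Finset.induction_on generalizing n with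
  | empty =>
    simp only [Finset.card_empty, pow_zero]
    have h1 : prodCoord (∅ : Finset (Fin m)) = fun _ => (1 : ℝ) := by
      funext u; simp [prodCoord]
    rw [h1]
    rcases n with _ | n
    · simp
    · simp [iteratedFDeriv_succ_const]
  | insert j s hj ih =>
    have hprod : prodCoord (insert j s) = fun u => (fun u : Fin m → ℝ => u j) u * prodCoord s u := by
      funext u; simp [prodCoord, Finset.prod_insert hj]
    rw [hprod, Finset.card_insert_of_notMem hj]
    have hle := norm_iteratedFDeriv_mul_le (𝕜 := ℝ) (A := ℝ) (N := (n : ℕ∞))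
      (contDiff_apply ℝ ℝ j) (contDiff_prodCoord s) u (n := n) le_rfl
    refine hle.trans ?_
    -- only the terms `i = 0, 1` survive
    have hterm : ∀ i ∈ Finset.range (n + 1),
        (n.choose i : ℝ) * ‖iteratedFDeriv ℝ i (fun u : Fin m → ℝ => u j) u‖ *
          ‖iteratedFDeriv ℝ (n - i) (prodCoord s) u‖ ≤
        if i = 0 then (n + 1 : ℝ) ^ s.card else if i = 1 then n * (n : ℝ) ^ s.card else 0 := by
      intro i hi
      have hp := norm_iteratedFDeriv_proj_le j u i
      rcases i with _ | _ | i
      · simp only [if_true, Nat.choose_zero_right, Nat.cast_one, one_mul, Nat.sub_zero] at hp ⊢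
        calc ‖iteratedFDeriv ℝ 0 (fun u : Fin m → ℝ => u j) u‖ * ‖iteratedFDeriv ℝ n (prodCoord s) u‖
            ≤ 1 * (n + 1 : ℝ) ^ s.card := by
              gcongr
              exact hp.trans (hu j)
              exact ih n
          _ = (n + 1 : ℝ) ^ s.card := one_mul _
      · simp only [one_ne_zero, if_false, if_true, zero_add, Nat.choose_one_right] at hp ⊢
        have hn : 1 ≤ n := by
          have := Finset.mem_range.1 hi; omega
        calc (n : ℝ) * ‖iteratedFDeriv ℝ 1 (fun u : Fin m → ℝ => u j) u‖ *
              ‖iteratedFDeriv ℝ (n - 1) (prodCoord s) u‖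
            ≤ (n : ℝ) * 1 * ((n - 1 : ℕ) + 1 : ℝ) ^ s.card := by
              gcongr
              exact ih (n - 1)
          _ = n * (n : ℝ) ^ s.card := by
              rw [mul_one, Nat.cast_sub hn, Nat.cast_one, sub_add_cancel]
      · simp only [add_eq_zero, one_ne_zero, and_false, if_false, Nat.add_eq_right] at hp ⊢
        have h0 : ‖iteratedFDeriv ℝ (i + 2) (fun u : Fin m → ℝ => u j) u‖ = 0 :=
          le_antisymm hp (norm_nonneg _)
        rw [h0, mul_zero, zero_mul]
    refine (Finset.sum_le_sum hterm).trans ?_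
    rcases n with _ | n
    · simp
    · rw [Finset.sum_range_succ', Finset.sum_range_succ']
      simp only [add_eq_zero, one_ne_zero, and_false, if_false, Nat.add_eq_right, if_true,
        Finset.sum_const_zero, zero_add]
      have h1 : (n : ℝ) + 1 = (n + 1 : ℕ) := by push_cast; ring
      have hpow : ((n + 1 : ℕ) : ℝ) ^ s.card ≤ ((n + 1 : ℕ) + 1 : ℝ) ^ s.card :=
        pow_le_pow_left₀ (by positivity) (by simp) _
      calc ((n + 1 : ℕ) : ℝ) * ((n + 1 : ℕ) : ℝ) ^ s.card + ((n + 1 : ℕ) + 1 : ℝ) ^ s.card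
          ≤ ((n + 1 : ℕ) : ℝ) * ((n + 1 : ℕ) + 1 : ℝ) ^ s.card + ((n + 1 : ℕ) + 1 : ℝ) ^ s.card := by
            gcongr
        _ = ((n + 1 : ℕ) + 1 : ℝ) ^ (s.card + 1) := by ring

end ProdCoord

/-! ### Scalar functions of a linear functional -/

section CompCLM

variable {V : Type*} [NormedAddCommGroup V] [NormedSpace ℝ V]

/-- **`‖Dⁿ(h ∘ ℓ)(v)‖ ≤ ‖h⁽ⁿ⁾(ℓ v)‖ ‖ℓ‖ⁿ`** for a smooth scalar function `h : ℝ → ℂ` and a continuous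
linear functional `ℓ`. [folklore] -/
theorem norm_iteratedFDeriv_realComp_clm_le {h : ℝ → ℂ} (hh : ContDiff ℝ ∞ h) (ℓ : V →L[ℝ] ℝ)
    (n : ℕ) (v : V) :
    ‖iteratedFDeriv ℝ n (fun v => h (ℓ v)) v‖ ≤ ‖iteratedDeriv n h (ℓ v)‖ * ‖ℓ‖ ^ n := by
  have hcomp : (fun v => h (ℓ v)) = h ∘ ℓ := rfl
  rw [hcomp, ℓ.iteratedFDeriv_comp_right hh v (i := n) (mod_cast le_top)]
  refine (ContinuousMultilinearMap.norm_compContinuousLinearMap_le _ _).trans ?_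
  rw [Finset.prod_const, Finset.card_univ, Fintype.card_fin, norm_iteratedFDeriv_eq_norm_iteratedDeriv]

/-- The same for a real-valued `h`. [folklore] -/
theorem norm_iteratedFDeriv_realComp_clm_le_real {h : ℝ → ℝ} (hh : ContDiff ℝ ∞ h) (ℓ : V →L[ℝ] ℝ)
    (n : ℕ) (v : V) :
    ‖iteratedFDeriv ℝ n (fun v => h (ℓ v)) v‖ ≤ ‖iteratedDeriv n h (ℓ v)‖ * ‖ℓ‖ ^ n := by
  have hcomp : (fun v => h (ℓ v)) = h ∘ ℓ := rfl
  rw [hcomp, ℓ.iteratedFDeriv_comp_right hh v (i := n) (mod_cast le_top)]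
  refine (ContinuousMultilinearMap.norm_compContinuousLinearMap_le _ _).trans ?_
  rw [Finset.prod_const, Finset.card_univ, Fintype.card_fin, norm_iteratedFDeriv_eq_norm_iteratedDeriv]

end CompCLM

/-! ### The truncated exponential and its tail -/

section ExpTail

/-- The complex exponential `t ↦ e^{it}` of a real variable. [folklore] -/
def expI (t : ℝ) : ℂ := exp ((t : ℂ) * I)

/-- The truncated exponential series `∑_{l ≤ N} (it)^l / l!`. [folklore] -/
def expTrunc (N : ℕ) (t : ℝ) : ℂ := ∑ l ∈ Finset.range (N + 1), ((t : ℂ) * I) ^ l / (l ! : ℂ)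

/-- The tail `e^{it} − ∑_{l ≤ N} (it)^l / l!`. [folklore] -/
def expTail (N : ℕ) (t : ℝ) : ℂ := expI t - expTrunc N t

/-- `expTail N t + expTrunc N t = e^{it}`. [folklore] -/
theorem expTail_add_expTrunc (N : ℕ) (t : ℝ) : expTail N t + expTrunc N t = expI t :=
  sub_add_cancel _ _

/-- Derivative of `e^{it}`. [folklore] -/
theorem hasDerivAt_expI (t : ℝ) : HasDerivAt expI (I * expI t) t := by
  have h1 : HasDerivAt (fun t : ℝ => (t : ℂ) * I) I t := by
    simpa using (hasDerivAt_id t).ofReal_comp.mul_const I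
  have h2 : HasDerivAt (fun x : ℝ => cexp ((x : ℂ) * I)) (cexp ((t : ℂ) * I) * I) t := h1.cexp
  exact h2.congr_deriv (by rw [mul_comm]; rfl)

/-- Derivative of the monomial `(it)^{l+1}/(l+1)!` is `i (it)^l/l!`. [folklore] -/
theorem hasDerivAt_monomial (l : ℕ) (t : ℝ) :
    HasDerivAt (fun t : ℝ => ((t : ℂ) * I) ^ (l + 1) / ((l + 1)! : ℂ))
      (I * (((t : ℂ) * I) ^ l / (l ! : ℂ))) t := by
  have h1 : HasDerivAt (fun t : ℝ => (t : ℂ) * I) I t := by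
    simpa using (hasDerivAt_id t).ofReal_comp.mul_const I
  have h2 := (h1.fun_pow (l + 1)).div_const ((l + 1)! : ℂ)
  refine h2.congr_deriv ?_
  have hl : ((l : ℂ) + 1) ≠ 0 := Nat.cast_add_one_ne_zero l
  have hl' : (l ! : ℂ) ≠ 0 := by exact_mod_cast Nat.factorial_ne_zero _
  rw [Nat.add_sub_cancel, Nat.factorial_succ, Nat.cast_mul]
  push_cast
  field_simp

/-- Derivative of the truncated series: `d/dt ∑_{l ≤ N+1} (it)^l/l! = i ∑_{l ≤ N} (it)^l/l!`. [folklore] -/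
theorem hasDerivAt_expTrunc_succ (N : ℕ) (t : ℝ) :
    HasDerivAt (expTrunc (N + 1)) (I * expTrunc N t) t := by
  have hsum : expTrunc (N + 1) = fun t : ℝ => 1 + ∑ l ∈ Finset.range (N + 1),
      ((t : ℂ) * I) ^ (l + 1) / ((l + 1)! : ℂ) := by
    funext t
    rw [expTrunc, Finset.sum_range_succ']
    simp [add_comm]
  rw [hsum]
  have h := HasDerivAt.fun_sum (u := Finset.range (N + 1))
    (A := fun l (t : ℝ) => ((t : ℂ) * I) ^ (l + 1) / ((l + 1)! : ℂ))
    (A' := fun l => I * (((t : ℂ) * I) ^ l / (l ! : ℂ))) (x := t) fun l _ => hasDerivAt_monomial l t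
  refine ((hasDerivAt_const t (1 : ℂ)).add h).congr_deriv ?_
  rw [zero_add, expTrunc, Finset.mul_sum]

/-- **`d/dt expTail (N+1) = i · expTail N`.** [folklore] -/
theorem hasDerivAt_expTail_succ (N : ℕ) (t : ℝ) :
    HasDerivAt (expTail (N + 1)) (I * expTail N t) t := by
  have h := (hasDerivAt_expI t).sub (hasDerivAt_expTrunc_succ N t)
  have he : expTail (N + 1) = fun t => expI t - expTrunc (N + 1) t := rfl
  rw [he, expTail, mul_sub]
  exact h

/-- `deriv (expTail (N+1)) = i • expTail N`. [folklore] -/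
theorem deriv_expTail_succ (N : ℕ) : deriv (expTail (N + 1)) = fun t => I * expTail N t :=
  funext fun t => (hasDerivAt_expTail_succ N t).deriv

/-- `expI` is smooth. [folklore] -/
theorem contDiff_expI : ContDiff ℝ ∞ expI := by
  unfold expI
  exact Complex.contDiff_exp.comp ((Complex.ofRealCLM.contDiff).mul contDiff_const)

/-- `expTrunc N` is smooth. [folklore] -/
theorem contDiff_expTrunc (N : ℕ) : ContDiff ℝ ∞ (expTrunc N) := by
  unfold expTrunc
  refine ContDiff.sum fun l _ => ?_
  exact ((Complex.ofRealCLM.contDiff.mul contDiff_const).pow l).div_const _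

/-- `expTail N` is smooth. [folklore] -/
theorem contDiff_expTail (N : ℕ) : ContDiff ℝ ∞ (expTail N) :=
  contDiff_expI.sub (contDiff_expTrunc N)

/-- **Iterated derivatives of the tail**: `(expTail (N + j))⁽ʲ⁾ = i^j · expTail N`. [folklore] -/
theorem iteratedDeriv_expTail (N j : ℕ) :
    iteratedDeriv j (expTail (N + j)) = fun t => I ^ j * expTail N t := by
  induction j generalizing N with
  | zero => funext t; simp
  | succ j ih =>
    rw [iteratedDeriv_succ', show N + (j + 1) = (N + j) + 1 by ring, deriv_expTail_succ]
    funext t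
    rw [iteratedDeriv_const_mul_field, ih]
    ring

/-- **Uniform bound for the tail** (Lagrange form): `‖expTail N t‖ ≤ 2 |t|^{N+1} / (N+1)!` as soon
as `2 |t| ≤ N + 2` (`Complex.exp_bound'`). [folklore] -/
theorem norm_expTail_le {N : ℕ} {t : ℝ} (ht : 2 * |t| ≤ N + 2) :
    ‖expTail N t‖ ≤ 2 * |t| ^ (N + 1) / ((N + 1)! : ℝ) := by
  have hx : ‖(t : ℂ) * I‖ = |t| := by simp
  have hcond : ‖(t : ℂ) * I‖ / ((N + 1).succ : ℕ) ≤ 1 / 2 := by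
    rw [hx, div_le_div_iff₀ (by positivity) (by norm_num)]
    push_cast
    linarith
  have h := Complex.exp_bound' (x := (t : ℂ) * I) (n := N + 1) hcond
  rw [hx] at h
  calc ‖expTail N t‖ = ‖exp ((t : ℂ) * I) - ∑ l ∈ Finset.range (N + 1), ((t : ℂ) * I) ^ l / (l ! : ℂ)‖ := rfl
    _ ≤ |t| ^ (N + 1) / ((N + 1)! : ℝ) * 2 := h
    _ = 2 * |t| ^ (N + 1) / ((N + 1)! : ℝ) := by ring

/-- **The tail and its derivatives tend to zero uniformly on bounded sets**: for every radius `R`,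
order `n` and `ε > 0` there is `N₀` such that `‖(expTail N)⁽ʲ⁾(t)‖ ≤ ε` for all `N ≥ N₀`, `j ≤ n`,
`|t| ≤ R`. [folklore] -/
theorem exists_forall_norm_iteratedDeriv_expTail_le (R : ℝ) (n : ℕ) {ε : ℝ} (hε : 0 < ε) :
    ∃ N₀ : ℕ, ∀ N, N₀ ≤ N → ∀ j, j ≤ n → ∀ t : ℝ, |t| ≤ R →
      ‖iteratedDeriv j (expTail N) t‖ ≤ ε := by
  -- `|R|^M / M! → 0`
  have hsum : Summable fun M : ℕ => |R| ^ M / (M ! : ℝ) := Real.summable_pow_div_factorial |R|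
  have hlim : Tendsto (fun M : ℕ => |R| ^ M / (M ! : ℝ)) atTop (𝓝 0) := hsum.tendsto_atTop_zero
  have hε2 : 0 < ε / 2 := by linarith
  obtain ⟨M₀, hM₀⟩ := (tendsto_order.1 hlim).2 (ε / 2) hε2 |>.exists_forall_of_atTop
  -- choose `N₀` with `N₀ - n ≥ M₀` and `N₀ - n + 2 ≥ 2 R`
  obtain ⟨K, hK⟩ := exists_nat_ge (2 * |R|)
  refine ⟨M₀ + K + n, fun N hN j hj t ht => ?_⟩
  -- write `N = N' + j`
  obtain ⟨N', rfl⟩ : ∃ N', N = N' + j := ⟨N - j, by omega⟩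
  rw [iteratedDeriv_expTail]
  simp only [norm_mul, norm_pow, Complex.norm_I, one_pow, one_mul]
  have htR : |t| ≤ |R| := ht.trans (le_abs_self R)
  have hcond : 2 * |t| ≤ N' + 2 := by
    have : (K : ℝ) ≤ N' := by exact_mod_cast (by omega : K ≤ N')
    linarith
  refine (norm_expTail_le hcond).trans ?_
  have hM : M₀ ≤ N' + 1 := by omega
  have h1 := hM₀ (N' + 1) hM
  have h2 : |t| ^ (N' + 1) / ((N' + 1)! : ℝ) ≤ |R| ^ (N' + 1) / ((N' + 1)! : ℝ) := by
    gcongr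
  have h3 : |t| ^ (N' + 1) / ((N' + 1)! : ℝ) ≤ ε / 2 := h2.trans h1.le
  calc 2 * |t| ^ (N' + 1) / ((N' + 1)! : ℝ) = 2 * (|t| ^ (N' + 1) / ((N' + 1)! : ℝ)) := by ring
    _ ≤ 2 * (ε / 2) := by linarith
    _ = ε := by ring

end ExpTail

/-! ### Norms of vector-valued iterated derivatives -/

section Pi

variable {𝕜 : Type*} [NontriviallyNormedField 𝕜] {E : Type*} [NormedAddCommGroup E]
  [NormedSpace 𝕜 E] {ι : Type*} [Fintype ι] {F' : ι → Type*} [∀ i, NormedAddCommGroup (F' i)]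
  [∀ i, NormedSpace 𝕜 (F' i)]

/-- **The iterated derivative of a `Π`-valued map is the `pi` of the iterated derivatives of its
components** (uniqueness of Taylor series). [folklore] -/
theorem iteratedFDeriv_pi {φ : ∀ i, E → F' i} (hφ : ∀ i, ContDiff 𝕜 ∞ (φ i)) (k : ℕ) (x : E) :
    iteratedFDeriv 𝕜 k (fun x i => φ i x) x =
      ContinuousMultilinearMap.pi fun i => iteratedFDeriv 𝕜 k (φ i) x := by
  have h : HasFTaylorSeriesUpTo ∞ (fun x i => φ i x)
      fun x m => ContinuousMultilinearMap.pi fun i => ftaylorSeries 𝕜 (φ i) x m := by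
    rw [← hasFTaylorSeriesUpToOn_univ_iff]
    exact hasFTaylorSeriesUpToOn_pi.2 fun i =>
      (hasFTaylorSeriesUpToOn_univ_iff.2 (contDiff_iff_ftaylorSeries.1 (hφ i)))
  exact (h.eq_iteratedFDeriv (m := k) (mod_cast le_top) x).symm

/-- **Sup bound for `Π`-valued maps**: if every component satisfies `‖Dᵏ φᵢ (x)‖ ≤ C` (`C ≥ 0`),
then `‖Dᵏ (x ↦ (φᵢ x)ᵢ)‖ ≤ C`. [folklore] -/
theorem norm_iteratedFDeriv_pi_le {φ : ∀ i, E → F' i} (hφ : ∀ i, ContDiff 𝕜 ∞ (φ i)) (k : ℕ)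
    (x : E) {C : ℝ} (hC : 0 ≤ C) (h : ∀ i, ‖iteratedFDeriv 𝕜 k (φ i) x‖ ≤ C) :
    ‖iteratedFDeriv 𝕜 k (fun x i => φ i x) x‖ ≤ C := by
  rw [iteratedFDeriv_pi hφ, ContinuousMultilinearMap.opNorm_pi]
  exact (pi_norm_le_iff_of_nonneg hC).2 h

variable {F G : Type*} [NormedAddCommGroup F] [NormedSpace 𝕜 F] [NormedAddCommGroup G]
  [NormedSpace 𝕜 G]

/-- **Max bound for pair-valued maps**: `‖Dᵏ (f, g)(x)‖ ≤ max ‖Dᵏf(x)‖ ‖Dᵏg(x)‖`. [folklore] -/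
theorem norm_iteratedFDeriv_prodMk_le {f : E → F} {g : E → G} (hf : ContDiff 𝕜 ∞ f)
    (hg : ContDiff 𝕜 ∞ g) (k : ℕ) (x : E) :
    ‖iteratedFDeriv 𝕜 k (fun x => (f x, g x)) x‖ ≤
      max ‖iteratedFDeriv 𝕜 k f x‖ ‖iteratedFDeriv 𝕜 k g x‖ := by
  rw [iteratedFDeriv_prodMk (hf.contDiffAt (n := ∞)) (hg.contDiffAt (n := ∞)) (mod_cast le_top),
    ContinuousMultilinearMap.opNorm_prod]

end Pi

/-! ### The exponential change of variables `(σ, q) ↦ ((e^{−σᵢ})ᵢ, q)` -/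

section ExpNeg

variable {m : ℕ} {W : Type*}

variable (m W) in
/-- **The exponential change of variables** `expNegMap (σ, q) = ((e^{−σᵢ})ᵢ, q)` on `ℝ^m × W`,
sending the closed orthant `{σᵢ ≥ 0}` onto `(0, 1]^m × W` (the substitution `uᵢ = e^{−σᵢ}` that
turns exponential sums `∑ c_α e^{−⟨α, σ⟩}` into polynomials `∑ c_α u^α`). [folklore] -/
def expNegMap : (Fin m → ℝ) × W → (Fin m → ℝ) × W := fun x => (fun i => Real.exp (-(x.1 i)), x.2)

/-- Components of `expNegMap`. [folklore] -/
@[simp] theorem expNegMap_fst (x : (Fin m → ℝ) × W) (i : Fin m) :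
    (expNegMap m W x).1 i = Real.exp (-(x.1 i)) := rfl

/-- Components of `expNegMap`. [folklore] -/
@[simp] theorem expNegMap_snd (x : (Fin m → ℝ) × W) : (expNegMap m W x).2 = x.2 := rfl

/-- Iterated derivatives of the real exponential. [folklore] -/
theorem iteratedDeriv_real_exp (k : ℕ) : iteratedDeriv k Real.exp = Real.exp := by
  induction k with
  | zero => simp
  | succ k ih => rw [iteratedDeriv_succ, ih, Real.deriv_exp]

variable [NormedAddCommGroup W] [NormedSpace ℝ W]

/-- The linear functional `(σ, q) ↦ −σᵢ`. [folklore] -/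
def negCoord (i : Fin m) : ((Fin m → ℝ) × W) →L[ℝ] ℝ :=
  -((ContinuousLinearMap.proj (R := ℝ) (φ := fun _ : Fin m => ℝ) i).comp
      (ContinuousLinearMap.fst ℝ (Fin m → ℝ) W))

/-- Unfolding `negCoord`. [folklore] -/
@[simp] theorem negCoord_apply (i : Fin m) (x : (Fin m → ℝ) × W) : negCoord (W := W) i x = -(x.1 i) := rfl

/-- `‖negCoord i‖ ≤ 1`. [folklore] -/
theorem norm_negCoord_le (i : Fin m) : ‖negCoord (W := W) i‖ ≤ 1 := by
  refine ContinuousLinearMap.opNorm_le_bound _ zero_le_one fun x => ?_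
  rw [negCoord_apply, one_mul, norm_neg]
  exact (norm_le_pi_norm x.1 i).trans (norm_fst_le x)

/-- The `i`-th `u`-component of `expNegMap` is `exp ∘ negCoord i`. [folklore] -/
theorem expNegMap_fst_eq (i : Fin m) :
    (fun x : (Fin m → ℝ) × W => (expNegMap m W x).1 i) = fun x => Real.exp (negCoord (W := W) i x) := by
  funext x; simp

/-- `expNegMap` is smooth. [folklore] -/
theorem contDiff_expNegMap {N : ℕ∞} : ContDiff ℝ N (expNegMap m W) := by
  refine ContDiff.prodMk ?_ contDiff_snd
  refine contDiff_pi.2 fun i => ?_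
  have h : (fun x : (Fin m → ℝ) × W => Real.exp (-(x.1 i))) =
      fun x => Real.exp (negCoord (W := W) i x) := by funext x; simp
  show ContDiff ℝ N fun x : (Fin m → ℝ) × W => Real.exp (-(x.1 i))
  rw [h]
  exact Real.contDiff_exp.comp (negCoord (W := W) i).contDiff

/-- Derivatives of the `u`-components: `‖Dᵏ (x ↦ e^{−σᵢ})‖ ≤ e^{−σᵢ}`. [folklore] -/
theorem norm_iteratedFDeriv_expNegMap_fst_le (i : Fin m) (k : ℕ) (x : (Fin m → ℝ) × W) :
    ‖iteratedFDeriv ℝ k (fun x : (Fin m → ℝ) × W => (expNegMap m W x).1 i) x‖ ≤ Real.exp (-(x.1 i)) := by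
  rw [expNegMap_fst_eq]
  refine (norm_iteratedFDeriv_realComp_clm_le_real Real.contDiff_exp (negCoord (W := W) i) k x).trans ?_
  rw [iteratedDeriv_real_exp, negCoord_apply, Real.norm_eq_abs, abs_of_pos (Real.exp_pos _)]
  have h1 : ‖negCoord (W := W) i‖ ^ k ≤ 1 := pow_le_one₀ (norm_nonneg _) (norm_negCoord_le i)
  calc Real.exp (-(x.1 i)) * ‖negCoord (W := W) i‖ ^ k ≤ Real.exp (-(x.1 i)) * 1 := by
        gcongr
    _ = Real.exp (-(x.1 i)) := mul_one _

/-- Derivatives of order `≥ 1` of the second projection have norm `≤ 1`. [folklore] -/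
theorem norm_iteratedFDeriv_snd_le {k : ℕ} (hk : 1 ≤ k) (x : (Fin m → ℝ) × W) :
    ‖iteratedFDeriv ℝ k (fun x : (Fin m → ℝ) × W => x.2) x‖ ≤ 1 := by
  have hf : (fun x : (Fin m → ℝ) × W => x.2) = ⇑(ContinuousLinearMap.snd ℝ (Fin m → ℝ) W) := rfl
  rcases k with _ | _ | k
  · omega
  · rw [norm_iteratedFDeriv_one, hf, ContinuousLinearMap.fderiv]
    exact ContinuousLinearMap.norm_snd_le ℝ (Fin m → ℝ) W
  · have hfd : fderiv ℝ (fun x : (Fin m → ℝ) × W => x.2) = fun _ =>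
        (ContinuousLinearMap.snd ℝ (Fin m → ℝ) W) := by
      rw [hf]; funext x; exact ContinuousLinearMap.fderiv _
    rw [← norm_iteratedFDeriv_fderiv, hfd, iteratedFDeriv_succ_const, Pi.zero_apply, norm_zero]
    exact zero_le_one

/-- **All derivatives of order `≥ 1` of `expNegMap` are bounded by `e` on `{σᵢ ≥ −1}`** (hence by
`e^k`): the hypothesis `D` of `norm_iteratedFDeriv_comp_le`. [folklore] -/
theorem norm_iteratedFDeriv_expNegMap_le {x : (Fin m → ℝ) × W} (hx : ∀ i, -1 ≤ x.1 i) {k : ℕ}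
    (hk : 1 ≤ k) : ‖iteratedFDeriv ℝ k (expNegMap m W) x‖ ≤ Real.exp 1 ^ k := by
  have hfst : ContDiff ℝ ∞ fun x : (Fin m → ℝ) × W => (expNegMap m W x).1 :=
    contDiff_fst.comp contDiff_expNegMap
  have h := norm_iteratedFDeriv_prodMk_le (𝕜 := ℝ) hfst contDiff_snd k x
  have heq : (fun x : (Fin m → ℝ) × W => ((expNegMap m W x).1, x.2)) = expNegMap m W := by
    funext x; rfl
  rw [heq] at h
  refine h.trans (max_le ?_ ?_)
  · have hcomp : ∀ i, ContDiff ℝ ∞ fun x : (Fin m → ℝ) × W => (expNegMap m W x).1 i := fun i => by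
      rw [expNegMap_fst_eq]
      exact Real.contDiff_exp.comp (negCoord (W := W) i).contDiff
    have hpi := norm_iteratedFDeriv_pi_le (𝕜 := ℝ) hcomp k x (Real.exp_pos 1).le fun i =>
      (norm_iteratedFDeriv_expNegMap_fst_le i k x).trans (Real.exp_le_exp.2 (by linarith [hx i]))
    refine (le_of_eq ?_).trans (hpi.trans ?_)
    · rfl
    · calc Real.exp 1 = Real.exp 1 ^ 1 := (pow_one _).symm
        _ ≤ Real.exp 1 ^ k := pow_le_pow_right₀ (Real.one_le_exp zero_le_one) hk
  · calc ‖iteratedFDeriv ℝ k (fun x : (Fin m → ℝ) × W => x.2) x‖ ≤ 1 := norm_iteratedFDeriv_snd_le hk x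
      _ ≤ Real.exp 1 ^ k := one_le_pow₀ (Real.one_le_exp zero_le_one)

end ExpNeg

end Literature.Analysis.Distribution
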